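import Literature.NumberTheory.GaloisRepresentations.AbsIntegersValuationSubringsMaximalIdeals
import Literature.NumberTheory.GaloisRepresentations.AbsGaloisConjByPrime
import Literature.NumberTheory.GaloisRepresentations.DecompositionGroupOfCompletion
import Literature.NumberTheory.GaloisRepresentations.ClosureValuationSubring
import HarnessLib

/-!
# A Frobenius lift `σ̃` on the valuation ring `ℤ̄_𝔓 ⊆ K̄`, and `ℤ̄_{𝔓₀} = ι⁻¹(R)` at the prime of a completion

Topic `NumberTheory/GaloisRepresentations`; THEOREMS ONLY (no `def`, no named fact, no `sorry`).  Cell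
`hodgecm-mathlib` (D-0151), row II-1, edition E4 «Q5», pieces **(T1)+(T2)** of the map of record
(`B-provers/B-p09/Q5-MAP.md`; B-p07's slot (T3) «Frobenius translate at the base point» consumes them).

Let `K` be a number field, `ℤ̄ = absIntegers (𝓞 K) K ⊆ K̄`, `𝔓` a maximal ideal of `ℤ̄`, `V = ℤ̄_𝔓`
(`absIntegersValuationSubring 𝔓`, a valuation ring of `K̄` with centre `𝔓`), and `σ̃ : K̄ ≃+* K̄` with
`σ̃ x ≡ x ^ q (mod 𝔓)` on `ℤ̄` (`q ≥ 1`) — the currency of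
`exists_algEquiv_algebraicClosure_lift_of_isArithFrobAt` (clause 2) and of `TateSpecialisation.conjFrob`.

* §1 (T2): `σ̃ V = V` (`apply_mem_absIntegersValuationSubring_iff`), so `σ̃` restricts to a bijective ring
  endomorphism `σ̃|_V = σ̃.toRingHom.restrict V V _` of `V`; its RESIDUE ACTION is the `q`-power map:
  `residue V (σ̃ x) = (residue V x) ^ q` (`residue_apply_eq_pow`), equivalently
  `ResidueField.map σ̃|_V = (· ^ q)`; and `σ̃|_V` lies over `γ` on `K ∩ V ⊇ 𝓞_{K,v}`.
* §2 (T1): at the prime `𝔓₀ = adicCompletionPrime K v` cut out by the embedding `ι : K̄ → \bar K_v`,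
  `ι⁻¹(R) = ℤ̄_{𝔓₀}` for the valuation ring `R = closureValuationSubring K_v` of `\bar K_v`
  (`comap_closureValuationSubring_absClosureEmbedding`): `ι` maps `ℤ̄_{𝔓₀}` into `R`, units to units and
  non-units to non-units, and `𝓞_{K,v} ⊆ ℤ̄_{𝔓₀}`.

References: J. Neukirch, *Algebraic Number Theory* (1999), Ch. I §9 (decomposition group, Frobenius,
`σ𝒪 = 𝒪`), Ch. II §8 (primes of `K̄` above `v` ↔ embeddings `K̄ → \bar K_v`); J.-P. Serre, *Local Fields*
(1979), Ch. I §7 Prop. 19–21.  HC_CM is proved only modulo the 7 printed citations until rung 0 closes.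
-/

set_option autoImplicit false

noncomputable section

open Field IsLocalRing IsDedekindDomain
open Literature.NumberTheory.NumberFields
open scoped NumberField

namespace Literature.NumberTheory.GaloisRepresentations

/-! ## §1 (T2) The Frobenius lift on `ℤ̄_𝔓` -/

section Frobenius

variable {K : Type} [Field K] [NumberField K] (𝔓 : Ideal (absIntegers (𝓞 K) K)) [𝔓.IsMaximal]
  (σt : AlgebraicClosure K ≃+* AlgebraicClosure K) (q : ℕ)
  (hσ𝔓 : ∀ x : absIntegers (𝓞 K) K, ∃ hx : σt x ∈ absIntegers (𝓞 K) K,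
    (⟨σt x, hx⟩ : absIntegers (𝓞 K) K) - x ^ q ∈ 𝔓)

include hσ𝔓

omit [NumberField K] in
/-- `σ̃` maps `ℤ̄ ∖ 𝔓` to itself (`σ̃ 𝔓 = 𝔓`). [cite: NeukirchANT1999, Ch. I §9 Def. (9.5) and Prop. (9.1)] -/
theorem apply_coe_notMem_of_notMem (hq : 1 ≤ q) {d : absIntegers (𝓞 K) K} (hd : d ∉ 𝔓) :
    (⟨σt d, (hσ𝔓 d).1⟩ : absIntegers (𝓞 K) K) ∉ 𝔓 := fun h =>
  hd ((apply_mem_prime_iff_of_sub_pow_mem σt 𝔓 q hσ𝔓 hq d).1 h)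

omit [NumberField K] in
/-- `σ̃⁻¹` maps `ℤ̄ ∖ 𝔓` to itself. [cite: NeukirchANT1999, Ch. I §9 Def. (9.5) and Prop. (9.1)] -/
theorem symm_apply_coe_notMem_of_notMem (hq : 1 ≤ q) {d : absIntegers (𝓞 K) K} (hd : d ∉ 𝔓) :
    (⟨σt.symm d, ringEquiv_apply_mem_absIntegers σt.symm d.2⟩ : absIntegers (𝓞 K) K) ∉ 𝔓 := fun h =>
  hd ((symm_apply_mem_prime_iff_of_sub_pow_mem σt 𝔓 q hσ𝔓 hq d).1 h)

/-- **`σ̃ (ℤ̄_𝔓) ⊆ ℤ̄_𝔓`**: `σ̃ (n / d) = σ̃ n / σ̃ d` with `σ̃ d ∉ 𝔓`. [cite: NeukirchANT1999, Ch. I §9 Prop. (9.1)] -/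
theorem apply_mem_absIntegersValuationSubring (hq : 1 ≤ q) {x : AlgebraicClosure K}
    (hx : x ∈ absIntegersValuationSubring 𝔓) : σt x ∈ absIntegersValuationSubring 𝔓 := by
  rw [mem_absIntegersValuationSubring_iff, mem_absIntegersLocalization_iff] at hx ⊢
  obtain ⟨n, d, hd, hxd⟩ := hx
  refine ⟨⟨σt n, (hσ𝔓 n).1⟩, ⟨σt d, (hσ𝔓 d).1⟩, apply_coe_notMem_of_notMem 𝔓 σt q hσ𝔓 hq hd, ?_⟩
  change σt x * σt d = σt n
  rw [← map_mul, hxd]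

/-- **`σ̃⁻¹ (ℤ̄_𝔓) ⊆ ℤ̄_𝔓`**. [cite: NeukirchANT1999, Ch. I §9 Prop. (9.1)] -/
theorem symm_apply_mem_absIntegersValuationSubring (hq : 1 ≤ q) {x : AlgebraicClosure K}
    (hx : x ∈ absIntegersValuationSubring 𝔓) : σt.symm x ∈ absIntegersValuationSubring 𝔓 := by
  rw [mem_absIntegersValuationSubring_iff, mem_absIntegersLocalization_iff] at hx ⊢
  obtain ⟨n, d, hd, hxd⟩ := hx
  refine ⟨⟨σt.symm n, ringEquiv_apply_mem_absIntegers σt.symm n.2⟩,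
    ⟨σt.symm d, ringEquiv_apply_mem_absIntegers σt.symm d.2⟩,
    symm_apply_coe_notMem_of_notMem 𝔓 σt q hσ𝔓 hq hd, ?_⟩
  change σt.symm x * σt.symm d = σt.symm n
  rw [← map_mul, hxd]

/-- **`σ̃ (ℤ̄_𝔓) = ℤ̄_𝔓`**: `σ̃ x ∈ ℤ̄_𝔓 ↔ x ∈ ℤ̄_𝔓`. [cite: NeukirchANT1999, Ch. I §9 Prop. (9.1)] -/
theorem apply_mem_absIntegersValuationSubring_iff (hq : 1 ≤ q) (x : AlgebraicClosure K) :
    σt x ∈ absIntegersValuationSubring 𝔓 ↔ x ∈ absIntegersValuationSubring 𝔓 := by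
  refine ⟨fun h => ?_, apply_mem_absIntegersValuationSubring 𝔓 σt q hσ𝔓 hq⟩
  have h' := symm_apply_mem_absIntegersValuationSubring 𝔓 σt q hσ𝔓 hq h
  rwa [RingEquiv.symm_apply_apply] at h'

/-- The hypothesis of `RingHom.restrict` for `σ̃|_{ℤ̄_𝔓}`. [cite: NeukirchANT1999, Ch. I §9 Prop. (9.1)] -/
theorem forall_apply_mem_absIntegersValuationSubring (hq : 1 ≤ q) :
    ∀ x ∈ absIntegersValuationSubring 𝔓, σt.toRingHom x ∈ absIntegersValuationSubring 𝔓 :=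
  fun _ hx => apply_mem_absIntegersValuationSubring 𝔓 σt q hσ𝔓 hq hx

/-- `σ̃|_{ℤ̄_𝔓}` on underlying elements. [cite: NeukirchANT1999, Ch. I §9 Prop. (9.1)] -/
theorem coe_restrict_absIntegersValuationSubring_apply (hq : 1 ≤ q) (x : absIntegersValuationSubring 𝔓) :
    ((σt.toRingHom.restrict (absIntegersValuationSubring 𝔓) (absIntegersValuationSubring 𝔓)
        (forall_apply_mem_absIntegersValuationSubring 𝔓 σt q hσ𝔓 hq) x : absIntegersValuationSubring 𝔓) :
          AlgebraicClosure K) = σt x :=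
  rfl

/-- `σ̃|_{ℤ̄_𝔓}` is bijective (inverse `σ̃⁻¹|_{ℤ̄_𝔓}`). [cite: NeukirchANT1999, Ch. I §9 Prop. (9.1)] -/
theorem restrict_absIntegersValuationSubring_bijective (hq : 1 ≤ q) :
    Function.Bijective (σt.toRingHom.restrict (absIntegersValuationSubring 𝔓) (absIntegersValuationSubring 𝔓)
      (forall_apply_mem_absIntegersValuationSubring 𝔓 σt q hσ𝔓 hq)) := by
  refine ⟨fun x y hxy => Subtype.ext (σt.injective (congrArg Subtype.val hxy)), fun y => ?_⟩
  exact ⟨⟨σt.symm y, symm_apply_mem_absIntegersValuationSubring 𝔓 σt q hσ𝔓 hq y.2⟩,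
    Subtype.ext (σt.apply_symm_apply (y : AlgebraicClosure K))⟩

omit hσ𝔓 in
/-- An algebraic integer outside `𝔓` is a unit of `ℤ̄_𝔓`: its residue is non-zero.
[cite: NeukirchANT1999, Ch. II §8] -/
theorem residue_absIntegersToValuationSubring_ne_zero {d : absIntegers (𝓞 K) K} (hd : d ∉ 𝔓) :
    residue (absIntegersValuationSubring 𝔓)
        (absIntegersToValuationSubring (absIntegersValuationSubring 𝔓) d) ≠ 0 := by
  rw [Ne, residue_eq_zero_iff, IsLocalRing.mem_maximalIdeal, mem_nonunits_iff, not_not]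
  have hd' : d ∉ absIntegersCentre (absIntegersValuationSubring 𝔓) := by
    rwa [absIntegersCentre_absIntegersValuationSubring]
  obtain ⟨hd0, hdinv⟩ := (not_mem_absIntegersCentre_iff _ d).1 hd'
  exact ⟨⟨absIntegersToValuationSubring _ d, ⟨(d : AlgebraicClosure K)⁻¹, hdinv⟩,
    Subtype.ext (mul_inv_cancel₀ hd0), Subtype.ext (inv_mul_cancel₀ hd0)⟩, rfl⟩

omit hσ𝔓 in
/-- An algebraic integer in `𝔓` has residue `0` in `ℤ̄_𝔓`. [cite: NeukirchANT1999, Ch. II §8] -/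
theorem residue_absIntegersToValuationSubring_eq_zero {n : absIntegers (𝓞 K) K} (hn : n ∈ 𝔓) :
    residue (absIntegersValuationSubring 𝔓)
        (absIntegersToValuationSubring (absIntegersValuationSubring 𝔓) n) = 0 := by
  rw [residue_eq_zero_iff]
  change n ∈ absIntegersCentre (absIntegersValuationSubring 𝔓)
  rw [absIntegersCentre_absIntegersValuationSubring]
  exact hn

/-- On algebraic integers, `σ̃` acts on residues of `ℤ̄_𝔓` as the `q`-power map: `res (σ̃ n) = (res n) ^ q`.
[cite: NeukirchANT1999, Ch. I §9 Def. (9.5)] -/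
theorem residue_absIntegersToValuationSubring_apply_eq_pow (n : absIntegers (𝓞 K) K) :
    residue (absIntegersValuationSubring 𝔓)
        (absIntegersToValuationSubring (absIntegersValuationSubring 𝔓) ⟨σt n, (hσ𝔓 n).1⟩) =
      residue (absIntegersValuationSubring 𝔓)
        (absIntegersToValuationSubring (absIntegersValuationSubring 𝔓) n) ^ q := by
  obtain ⟨hn, h⟩ := hσ𝔓 n
  have h0 := residue_absIntegersToValuationSubring_eq_zero 𝔓 h
  rw [map_sub, map_pow, map_sub, map_pow, sub_eq_zero] at h0
  exact h0

/-- **The residue action of `σ̃` on `ℤ̄_𝔓` is the `q`-power map**: `res (σ̃ x) = (res x) ^ q` for every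
`x ∈ ℤ̄_𝔓` (write `x = n / d`, `d ∉ 𝔓`; `σ̃ n ≡ n^q`, `σ̃ d ≡ d^q (mod 𝔓)` and `d̄ ≠ 0`).
[cite: NeukirchANT1999, Ch. I §9 Def. (9.5) and Prop. (9.4)] -/
theorem residue_apply_eq_pow (hq : 1 ≤ q) (x : absIntegersValuationSubring 𝔓) :
    residue (absIntegersValuationSubring 𝔓)
        ⟨σt x, apply_mem_absIntegersValuationSubring 𝔓 σt q hσ𝔓 hq x.2⟩ =
      residue (absIntegersValuationSubring 𝔓) x ^ q := by
  obtain ⟨n, d, hd, hxd⟩ := (mem_absIntegersValuationSubring_iff 𝔓).1 x.2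
  -- `x d = n` and `σ̃ x · σ̃ d = σ̃ n` in `V = ℤ̄_𝔓`
  have hxdV : x * absIntegersToValuationSubring (absIntegersValuationSubring 𝔓) d =
      absIntegersToValuationSubring (absIntegersValuationSubring 𝔓) n := Subtype.ext hxd
  have hσxdV : (⟨σt x, apply_mem_absIntegersValuationSubring 𝔓 σt q hσ𝔓 hq x.2⟩ : absIntegersValuationSubring 𝔓) *
        absIntegersToValuationSubring (absIntegersValuationSubring 𝔓) ⟨σt d, (hσ𝔓 d).1⟩ =
      absIntegersToValuationSubring (absIntegersValuationSubring 𝔓) ⟨σt n, (hσ𝔓 n).1⟩ :=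
    Subtype.ext (by
      change σt x * σt d = σt n
      rw [← map_mul]
      exact congrArg σt hxd)
  have hd0 := residue_absIntegersToValuationSubring_ne_zero 𝔓 hd
  have hσn := residue_absIntegersToValuationSubring_apply_eq_pow 𝔓 σt q hσ𝔓 n
  have hσd := residue_absIntegersToValuationSubring_apply_eq_pow 𝔓 σt q hσ𝔓 d
  have h1 := congrArg (residue (absIntegersValuationSubring 𝔓)) hσxdV
  rw [map_mul, hσd, hσn, ← hxdV, map_mul, mul_pow] at h1
  exact mul_right_cancel₀ (pow_ne_zero q hd0) h1

/-- The same for the restricted ring endomorphism `σ̃|_{ℤ̄_𝔓}`. [cite: NeukirchANT1999, Ch. I §9 Def. (9.5)] -/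
theorem residue_restrict_absIntegersValuationSubring (hq : 1 ≤ q) (x : absIntegersValuationSubring 𝔓) :
    residue (absIntegersValuationSubring 𝔓)
        (σt.toRingHom.restrict (absIntegersValuationSubring 𝔓) (absIntegersValuationSubring 𝔓)
          (forall_apply_mem_absIntegersValuationSubring 𝔓 σt q hσ𝔓 hq) x) =
      residue (absIntegersValuationSubring 𝔓) x ^ q :=
  residue_apply_eq_pow 𝔓 σt q hσ𝔓 hq x

/-- `σ̃|_{ℤ̄_𝔓}` is a local homomorphism (it is a ring automorphism of the local ring `ℤ̄_𝔓`).
[cite: NeukirchANT1999, Ch. I §9 Prop. (9.1)] -/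
theorem isLocalHom_restrict_absIntegersValuationSubring (hq : 1 ≤ q) :
    IsLocalHom (σt.toRingHom.restrict (absIntegersValuationSubring 𝔓) (absIntegersValuationSubring 𝔓)
      (forall_apply_mem_absIntegersValuationSubring 𝔓 σt q hσ𝔓 hq)) := by
  refine ⟨fun a ha => ?_⟩
  let e := RingEquiv.ofBijective _ (restrict_absIntegersValuationSubring_bijective 𝔓 σt q hσ𝔓 hq)
  have h := ha.map e.symm
  have he : e.symm (σt.toRingHom.restrict (absIntegersValuationSubring 𝔓) (absIntegersValuationSubring 𝔓)
      (forall_apply_mem_absIntegersValuationSubring 𝔓 σt q hσ𝔓 hq) a) = a := e.symm_apply_apply a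
  rwa [he] at h

/-- **On the residue field, `σ̃|_{ℤ̄_𝔓}` induces the `q`-power map.** [cite: NeukirchANT1999, Ch. I §9 Prop. (9.4)] -/
theorem residueField_map_restrict_absIntegersValuationSubring (hq : 1 ≤ q)
    (y : ResidueField (absIntegersValuationSubring 𝔓)) :
    haveI := isLocalHom_restrict_absIntegersValuationSubring 𝔓 σt q hσ𝔓 hq
    ResidueField.map (σt.toRingHom.restrict (absIntegersValuationSubring 𝔓) (absIntegersValuationSubring 𝔓)
      (forall_apply_mem_absIntegersValuationSubring 𝔓 σt q hσ𝔓 hq)) y = y ^ q := by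
  obtain ⟨x, rfl⟩ := residue_surjective y
  rw [ResidueField.map_residue]
  exact residue_apply_eq_pow 𝔓 σt q hσ𝔓 hq x

omit hσ𝔓 in
/-- `K`-elements of the local ring `𝓞_{K,v}` lie in `ℤ̄_𝔓` for every `𝔓 ∣ v` (`a / s` with `s ∉ v`, hence
`s ∉ 𝔓`). [cite: NeukirchANT1999, Ch. II §8] -/
theorem algebraMap_mem_absIntegersValuationSubring {v : HeightOneSpectrum (𝓞 K)} (h𝔓 : 𝔓 ∈ v.primesAbove)
    {a : K} (ha : a ∈ IsDedekindDomain.HeightOneSpectrum.valuationSubringAtPrime K v) :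
    algebraMap K (AlgebraicClosure K) a ∈ absIntegersValuationSubring 𝔓 := by
  obtain ⟨b, s, hs, rfl⟩ := ha
  rw [mem_absIntegersValuationSubring_iff, mem_absIntegersLocalization_iff]
  haveI := h𝔓.2
  refine ⟨algebraMap (𝓞 K) (absIntegers (𝓞 K) K) b, algebraMap (𝓞 K) (absIntegers (𝓞 K) K) s, ?_, ?_⟩
  · intro hmem
    apply hs
    have h1 : s ∈ 𝔓.under (𝓞 K) := hmem
    rwa [← Ideal.LiesOver.over (p := v.asIdeal) (P := 𝔓)] at h1
  · have hs0 : algebraMap (𝓞 K) K s ≠ 0 := fun h0 =>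
      hs (by
        have : s = 0 := IsFractionRing.injective (𝓞 K) K (by rw [h0, map_zero])
        rw [this]; exact v.asIdeal.zero_mem)
    have hcs : ((algebraMap (𝓞 K) (absIntegers (𝓞 K) K) s : absIntegers (𝓞 K) K) : AlgebraicClosure K) =
        algebraMap K (AlgebraicClosure K) (algebraMap (𝓞 K) K s) :=
      IsScalarTower.algebraMap_apply (𝓞 K) K (AlgebraicClosure K) s
    have hcb : ((algebraMap (𝓞 K) (absIntegers (𝓞 K) K) b : absIntegers (𝓞 K) K) : AlgebraicClosure K) =
        algebraMap K (AlgebraicClosure K) (algebraMap (𝓞 K) K b) :=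
      IsScalarTower.algebraMap_apply (𝓞 K) K (AlgebraicClosure K) b
    rw [hcs, hcb, map_mul, map_inv₀, inv_mul_cancel_right₀]
    exact (map_ne_zero_iff _ (algebraMap K (AlgebraicClosure K)).injective).mpr hs0

/-- **`σ̃|_{ℤ̄_𝔓}` lies over `γ` on `K`** (on underlying elements): for `σ̃ ∘ ι_K = ι_K ∘ γ` and `ι_K a ∈ ℤ̄_𝔓`,
`σ̃|_{ℤ̄_𝔓} (ι_K a) = ι_K (γ a)`. [cite: NeukirchANT1999, Ch. I §9 Prop. (9.1)] -/
theorem coe_restrict_absIntegersValuationSubring_algebraMap (hq : 1 ≤ q) (γ : K ≃+* K)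
    (hσa : ∀ a : K, σt (algebraMap K (AlgebraicClosure K) a) = algebraMap K (AlgebraicClosure K) (γ a))
    (a : K) (ha : algebraMap K (AlgebraicClosure K) a ∈ absIntegersValuationSubring 𝔓) :
    ((σt.toRingHom.restrict (absIntegersValuationSubring 𝔓) (absIntegersValuationSubring 𝔓)
        (forall_apply_mem_absIntegersValuationSubring 𝔓 σt q hσ𝔓 hq) ⟨algebraMap K (AlgebraicClosure K) a, ha⟩ :
          absIntegersValuationSubring 𝔓) : AlgebraicClosure K) =
      algebraMap K (AlgebraicClosure K) (γ a) :=
  hσa a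

end Frobenius

/-! ## §2 (T1) `ι⁻¹(R) = ℤ̄_𝔓` for a complete field `L ⊇ K` in place of `K_v`, then at `𝔓₀ = adicCompletionPrime K v`

As in `DecompositionGroupOfCompletion`, the local field is first an ABSTRACT complete `L ⊇ K` with a compatible
`ValuativeRel` structure (`hw`), `‖·‖ ≤ 1` on `𝓞 K` (`hO`) and a prime `𝔓` of `ℤ̄` cut out by the spectral norm of
`ι : K̄ → L̄` (`h𝔓`); the `K_v`-statements are the instantiations `hw := adicCompletion_valuation_le_one_iff K v`,
`hO := norm_algebraMap_ringOfIntegers_le_one K v`, `h𝔓 := mem_adicCompletionPrime_iff K v` (this keeps every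
`w.integer`-typed term abstract: the concrete `K_v` instances make such unifications time out). -/

section LocalField

open ValuativeRel

variable {K : Type} [Field K] [NumberField K] {L : Type*} [NontriviallyNormedField L] [CompleteSpace L]
  [IsUltrametricDist L] [Algebra K L] [ValuativeRel L] [IsNonarchimedeanLocalField L]
  (hw : ∀ x : L, valuation L x ≤ 1 ↔ ‖x‖ ≤ 1) (hO : ∀ r : 𝓞 K, ‖algebraMap (𝓞 K) L r‖ ≤ 1)
  (𝔓 : Ideal (absIntegers (𝓞 K) K))
  (h𝔓 : ∀ s : absIntegers (𝓞 K) K,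
    s ∈ 𝔓 ↔ spectralNorm L (AlgebraicClosure L) (absClosureEmbedding K L s) < 1)

omit [NumberField K] [CompleteSpace L] [IsUltrametricDist L] in
/-- The embedding `ι : K̄ → L̄` maps algebraic integers into the valuation ring `R` of `L̄` (every valuation ring
of `K̄`, such as `ι⁻¹(R)`, contains `ℤ̄`). [cite: NeukirchANT1999, Ch. II §8] -/
theorem absClosureEmbedding_coe_absIntegers_mem_closureValuationSubring (s : absIntegers (𝓞 K) K) :
    absClosureEmbedding K L (s : AlgebraicClosure K) ∈ closureValuationSubring L :=
  ValuationSubring.mem_comap.mp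
    (coe_absIntegers_mem_valuationSubring ((closureValuationSubring L).comap (absClosureEmbedding K L).toRingHom) s)

include hw hO h𝔓

omit [NumberField K] [CompleteSpace L] in
/-- **The centre dictionary**: `s ∈ 𝔓` iff `ι s` is a NON-unit of the valuation ring `R` of `L̄` — both say
«spectral norm `< 1`» (`h𝔓`; `mem_radical_map_maximalIdeal_iff hw`; `mem_absMaximalIdeal_iff_algNorm_lt_one`;
`mem_maximalIdeal_closureValuationSubring_iff`). [cite: NeukirchANT1999, Ch. II §8 (8.1)]
[cite: SerreLocalFields1979, Ch. II §2 Prop. 3 and Cor. 2] -/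
theorem mem_iff_absClosureEmbedding_mem_nonunits (s : absIntegers (𝓞 K) K) :
    s ∈ 𝔓 ↔ absClosureEmbedding K L (s : AlgebraicClosure K) ∈ (closureValuationSubring L).nonunits := by
  have hmem := absClosureEmbedding_coe_absIntegers_mem_closureValuationSubring (L := L) s
  have hint : absClosureEmbedding K L (s : AlgebraicClosure K) ∈ absIntegers (valuation L).integer L :=
    absClosureEmbedding_mem_absIntegers_integer K L (valuation L) (fun r => (hw _).mpr (hO r)) s
  rw [h𝔓, show absClosureEmbedding K L (s : AlgebraicClosure K) =
      ((⟨_, hmem⟩ : closureValuationSubring L) : AlgebraicClosure L) from rfl,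
    ValuationSubring.coe_mem_nonunits_iff, mem_maximalIdeal_closureValuationSubring_iff]
  exact (mem_radical_map_maximalIdeal_iff hw ⟨_, hint⟩).symm.trans
    (IsNonarchimedeanLocalField.mem_absMaximalIdeal_iff_algNorm_lt_one (F := L) (b := ⟨_, hint⟩))

omit [NumberField K] [CompleteSpace L] in
/-- **The centre of `ι⁻¹(R)` is `𝔓`.** [cite: NeukirchANT1999, Ch. II §8 (8.1)] -/
theorem absIntegersCentre_comap_closureValuationSubring :
    absIntegersCentre ((closureValuationSubring L).comap (absClosureEmbedding K L).toRingHom) = 𝔓 := by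
  ext s
  rw [mem_absIntegersCentre_iff', mem_iff_absClosureEmbedding_mem_nonunits hw hO 𝔓 h𝔓,
    ValuationSubring.mem_nonunits_iff_or, ValuationSubring.mem_comap]
  have e1 : (absClosureEmbedding K L).toRingHom ((s : AlgebraicClosure K)⁻¹) ∈ closureValuationSubring L ↔
      (absClosureEmbedding K L (s : AlgebraicClosure K))⁻¹ ∈ closureValuationSubring L := by
    rw [AlgHom.toRingHom_eq_coe, RingHom.coe_coe, map_inv₀]
  have e2 : (s : AlgebraicClosure K) = 0 ↔ absClosureEmbedding K L (s : AlgebraicClosure K) = 0 :=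
    (map_eq_zero_iff _ (absClosureEmbedding K L).toRingHom.injective).symm
  rw [e1, e2]

omit [CompleteSpace L] in
/-- **`ι⁻¹(R) = ℤ̄_𝔓`** (a valuation ring of `K̄` is determined by its centre). [cite: NeukirchANT1999, Ch. II §8 (8.1)] -/
theorem comap_closureValuationSubring_absClosureEmbedding [𝔓.IsMaximal] :
    (closureValuationSubring L).comap (absClosureEmbedding K L).toRingHom = absIntegersValuationSubring 𝔓 :=
  eq_absIntegersValuationSubring_of_absIntegersCentre_eq _ _
    (absIntegersCentre_comap_closureValuationSubring hw hO 𝔓 h𝔓)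

omit [CompleteSpace L] in
/-- Membership form: `ι x ∈ R ↔ x ∈ ℤ̄_𝔓`. [cite: NeukirchANT1999, Ch. II §8 (8.1)] -/
theorem absClosureEmbedding_mem_closureValuationSubring_iff [𝔓.IsMaximal] (x : AlgebraicClosure K) :
    absClosureEmbedding K L x ∈ closureValuationSubring L ↔ x ∈ absIntegersValuationSubring 𝔓 := by
  rw [← comap_closureValuationSubring_absClosureEmbedding hw hO 𝔓 h𝔓]
  rfl

omit [CompleteSpace L] in
/-- The hypothesis of `RingHom.restrict` for `ι|_{ℤ̄_𝔓} : ℤ̄_𝔓 → R`. [cite: NeukirchANT1999, Ch. II §8 (8.1)] -/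
theorem forall_absClosureEmbedding_mem_closureValuationSubring [𝔓.IsMaximal] :
    ∀ x ∈ absIntegersValuationSubring 𝔓, (absClosureEmbedding K L).toRingHom x ∈ closureValuationSubring L :=
  fun x hx => (absClosureEmbedding_mem_closureValuationSubring_iff hw hO 𝔓 h𝔓 x).mpr hx

omit [CompleteSpace L] in
/-- `ι|_{ℤ̄_𝔓}` on underlying elements. [cite: NeukirchANT1999, Ch. II §8 (8.1)] -/
theorem coe_restrict_absClosureEmbedding_apply [𝔓.IsMaximal] (x : absIntegersValuationSubring 𝔓) :
    (((absClosureEmbedding K L).toRingHom.restrict (absIntegersValuationSubring 𝔓) (closureValuationSubring L)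
        (forall_absClosureEmbedding_mem_closureValuationSubring hw hO 𝔓 h𝔓) x : closureValuationSubring L) :
          AlgebraicClosure L) = absClosureEmbedding K L x :=
  rfl

omit [CompleteSpace L] in
/-- **`ι|_{ℤ̄_𝔓} : ℤ̄_𝔓 → R` is a LOCAL homomorphism** (units to units, non-units to non-units: the two local rings
have the same centre `𝔓` on `ℤ̄`, and `ℤ̄_𝔓` consists of the fractions `n / d`, `d ∉ 𝔓`).
[cite: NeukirchANT1999, Ch. II §8 (8.1)] -/
theorem isLocalHom_restrict_absClosureEmbedding [𝔓.IsMaximal] :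
    IsLocalHom ((absClosureEmbedding K L).toRingHom.restrict (absIntegersValuationSubring 𝔓) (closureValuationSubring L)
        (forall_absClosureEmbedding_mem_closureValuationSubring hw hO 𝔓 h𝔓)) := by
  refine ⟨fun a ha => ?_⟩
  obtain ⟨n, d, hd, hnd⟩ := (mem_absIntegersValuationSubring_iff 𝔓).1 a.2
  have unit_of_notMem : ∀ {m : absIntegers (𝓞 K) K}, m ∉ 𝔓 →
      IsUnit (absIntegersToValuationSubring (absIntegersValuationSubring 𝔓) m) := by
    intro m hm
    have h := residue_absIntegersToValuationSubring_ne_zero 𝔓 hm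
    rwa [Ne, IsLocalRing.residue_eq_zero_iff, IsLocalRing.mem_maximalIdeal, mem_nonunits_iff, not_not] at h
  have hdu := unit_of_notMem hd
  have han : a * absIntegersToValuationSubring _ d = absIntegersToValuationSubring _ n := Subtype.ext hnd
  have h1 : IsUnit ((absClosureEmbedding K L).toRingHom.restrict (absIntegersValuationSubring 𝔓)
      (closureValuationSubring L) (forall_absClosureEmbedding_mem_closureValuationSubring hw hO 𝔓 h𝔓)
      (absIntegersToValuationSubring (absIntegersValuationSubring 𝔓) n)) := by
    rw [← han, map_mul]
    exact ha.mul (hdu.map _)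
  have hn𝔓 : n ∉ 𝔓 := by
    intro hmem
    rw [mem_iff_absClosureEmbedding_mem_nonunits hw hO 𝔓 h𝔓] at hmem
    have hmem' := (ValuationSubring.coe_mem_nonunits_iff (a := (⟨_,
      absClosureEmbedding_coe_absIntegers_mem_closureValuationSubring (L := L) n⟩ : closureValuationSubring L))).mp hmem
    exact (IsLocalRing.mem_maximalIdeal _).mp hmem' h1
  have hnu := unit_of_notMem hn𝔓
  obtain ⟨u, hu⟩ := hdu
  have hau : a = absIntegersToValuationSubring _ n * ((u⁻¹ : (absIntegersValuationSubring 𝔓)ˣ) :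
      absIntegersValuationSubring 𝔓) := by
    rw [← han, ← hu, mul_assoc, Units.mul_inv, mul_one]
  rw [hau]
  exact hnu.mul (Units.isUnit _)

end LocalField

/-! ### The completion `K_v`

The `K_v` statements are proved DIRECTLY (same proofs), not by instantiating the `L`-lemmas: the cell's
`closureValuationSubring (v.adicCompletion K)` carries the adic topology of `K_v`, the `L`-lemmas the norm topology,
and unifying the two structures does not terminate in practice. -/

section Completion

-- as in `GaloisRepUnramifiedProofs`: on `K_v` only Mathlib's global `instNormedFieldValuedAdicCompletion` and the
-- scoped `Valued.toNontriviallyNormedField` occur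
open scoped Valued

variable (K : Type) [Field K] [NumberField K] (v : HeightOneSpectrum (𝓞 K))
  [ValuativeRel (v.adicCompletion K)] [IsNonarchimedeanLocalField (v.adicCompletion K)]

/-- `ι : K̄ → \bar K_v` maps algebraic integers into `R = closureValuationSubring K_v`. [cite: NeukirchANT1999, Ch. II §8] -/
theorem absClosureEmbedding_coe_absIntegers_mem_closureValuationSubring_adicCompletion (s : absIntegers (𝓞 K) K) :
    absClosureEmbedding K (v.adicCompletion K) (s : AlgebraicClosure K) ∈
      closureValuationSubring (v.adicCompletion K) :=
  ValuationSubring.mem_comap.mp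
    (coe_absIntegers_mem_valuationSubring ((closureValuationSubring (v.adicCompletion K)).comap
      (absClosureEmbedding K (v.adicCompletion K)).toRingHom) s)

/-- **At `𝔓₀ = adicCompletionPrime K v`: `s ∈ 𝔓₀ ↔ ι s` is a non-unit of `R = closureValuationSubring K_v`.**
[cite: NeukirchANT1999, Ch. II §8 (8.1)] [cite: SerreLocalFields1979, Ch. II §2 Prop. 3 and Cor. 2] -/
theorem mem_adicCompletionPrime_iff_mem_nonunits (s : absIntegers (𝓞 K) K) :
    s ∈ adicCompletionPrime K v ↔
      absClosureEmbedding K (v.adicCompletion K) (s : AlgebraicClosure K) ∈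
        (closureValuationSubring (v.adicCompletion K)).nonunits := by
  have hmem := absClosureEmbedding_coe_absIntegers_mem_closureValuationSubring_adicCompletion K v s
  have hint := (mem_closureValuationSubring_iff_mem_absIntegers (F := v.adicCompletion K)).mp hmem
  rw [mem_adicCompletionPrime_iff, show absClosureEmbedding K (v.adicCompletion K) (s : AlgebraicClosure K) =
      ((⟨_, hmem⟩ : closureValuationSubring (v.adicCompletion K)) : AlgebraicClosure (v.adicCompletion K)) from rfl,
    ValuationSubring.coe_mem_nonunits_iff, mem_maximalIdeal_closureValuationSubring_iff]
  exact (mem_radical_map_maximalIdeal_iff (adicCompletion_valuation_le_one_iff K v) ⟨_, hint⟩).symm.trans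
    (IsNonarchimedeanLocalField.mem_absMaximalIdeal_iff_algNorm_lt_one (F := v.adicCompletion K) (b := ⟨_, hint⟩))

/-- **The centre of `ι⁻¹(R)` is `𝔓₀`** at `K_v`. [cite: NeukirchANT1999, Ch. II §8 (8.1)] -/
theorem absIntegersCentre_comap_closureValuationSubring_adicCompletion :
    absIntegersCentre ((closureValuationSubring (v.adicCompletion K)).comap
        (absClosureEmbedding K (v.adicCompletion K)).toRingHom) = adicCompletionPrime K v := by
  ext s
  rw [mem_absIntegersCentre_iff', mem_adicCompletionPrime_iff_mem_nonunits K v,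
    ValuationSubring.mem_nonunits_iff_or, ValuationSubring.mem_comap]
  have e1 : (absClosureEmbedding K (v.adicCompletion K)).toRingHom ((s : AlgebraicClosure K)⁻¹) ∈
        closureValuationSubring (v.adicCompletion K) ↔
      (absClosureEmbedding K (v.adicCompletion K) (s : AlgebraicClosure K))⁻¹ ∈
        closureValuationSubring (v.adicCompletion K) := by
    rw [AlgHom.toRingHom_eq_coe, RingHom.coe_coe, map_inv₀]
  have e2 : (s : AlgebraicClosure K) = 0 ↔ absClosureEmbedding K (v.adicCompletion K) (s : AlgebraicClosure K) = 0 :=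
    (map_eq_zero_iff _ (absClosureEmbedding K (v.adicCompletion K)).toRingHom.injective).symm
  rw [e1, e2]

/-- **`ι⁻¹(R) = ℤ̄_{𝔓₀}`** for `R = closureValuationSubring K_v`, `ι = absClosureEmbedding K K_v`,
`𝔓₀ = adicCompletionPrime K v`. [cite: NeukirchANT1999, Ch. II §8 (8.1)] -/
theorem comap_closureValuationSubring_adicCompletion :
    haveI := adicCompletionPrime_isMaximal K v
    (closureValuationSubring (v.adicCompletion K)).comap (absClosureEmbedding K (v.adicCompletion K)).toRingHom =
      absIntegersValuationSubring (adicCompletionPrime K v) :=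
  haveI := adicCompletionPrime_isMaximal K v
  eq_absIntegersValuationSubring_of_absIntegersCentre_eq _ _
    (absIntegersCentre_comap_closureValuationSubring_adicCompletion K v)

/-- Membership form at `K_v`: `ι x ∈ R ↔ x ∈ ℤ̄_{𝔓₀}`. [cite: NeukirchANT1999, Ch. II §8 (8.1)] -/
theorem absClosureEmbedding_mem_closureValuationSubring_adicCompletion_iff (x : AlgebraicClosure K) :
    haveI := adicCompletionPrime_isMaximal K v
    absClosureEmbedding K (v.adicCompletion K) x ∈ closureValuationSubring (v.adicCompletion K) ↔
      x ∈ absIntegersValuationSubring (adicCompletionPrime K v) := by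
  rw [← comap_closureValuationSubring_adicCompletion K v]
  rfl

/-- The `RingHom.restrict` hypothesis for `ι|_{ℤ̄_{𝔓₀}} : ℤ̄_{𝔓₀} → R` at `K_v`. [cite: NeukirchANT1999, Ch. II §8 (8.1)] -/
theorem forall_absClosureEmbedding_mem_closureValuationSubring_adicCompletion :
    haveI := adicCompletionPrime_isMaximal K v
    ∀ x ∈ absIntegersValuationSubring (adicCompletionPrime K v),
      (absClosureEmbedding K (v.adicCompletion K)).toRingHom x ∈ closureValuationSubring (v.adicCompletion K) :=
  fun x hx => (absClosureEmbedding_mem_closureValuationSubring_adicCompletion_iff K v x).mpr hx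

/-- `ι|_{ℤ̄_{𝔓₀}}` on underlying elements. [cite: NeukirchANT1999, Ch. II §8 (8.1)] -/
theorem coe_restrict_absClosureEmbedding_adicCompletion_apply
    (x : haveI := adicCompletionPrime_isMaximal K v; absIntegersValuationSubring (adicCompletionPrime K v)) :
    haveI := adicCompletionPrime_isMaximal K v
    (((absClosureEmbedding K (v.adicCompletion K)).toRingHom.restrict
        (absIntegersValuationSubring (adicCompletionPrime K v)) (closureValuationSubring (v.adicCompletion K))
        (forall_absClosureEmbedding_mem_closureValuationSubring_adicCompletion K v) x :
          closureValuationSubring (v.adicCompletion K)) : AlgebraicClosure (v.adicCompletion K)) =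
      absClosureEmbedding K (v.adicCompletion K) x :=
  rfl

/-- **`ι|_{ℤ̄_{𝔓₀}} : ℤ̄_{𝔓₀} → R` is a local homomorphism** at `K_v`. [cite: NeukirchANT1999, Ch. II §8 (8.1)] -/
theorem isLocalHom_restrict_absClosureEmbedding_adicCompletion :
    haveI := adicCompletionPrime_isMaximal K v
    IsLocalHom ((absClosureEmbedding K (v.adicCompletion K)).toRingHom.restrict
        (absIntegersValuationSubring (adicCompletionPrime K v)) (closureValuationSubring (v.adicCompletion K))
        (forall_absClosureEmbedding_mem_closureValuationSubring_adicCompletion K v)) := by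
  haveI := adicCompletionPrime_isMaximal K v
  refine ⟨fun a ha => ?_⟩
  obtain ⟨n, d, hd, hnd⟩ := (mem_absIntegersValuationSubring_iff (adicCompletionPrime K v)).1 a.2
  have unit_of_notMem : ∀ {m : absIntegers (𝓞 K) K}, m ∉ adicCompletionPrime K v →
      IsUnit (absIntegersToValuationSubring (absIntegersValuationSubring (adicCompletionPrime K v)) m) := by
    intro m hm
    have h := residue_absIntegersToValuationSubring_ne_zero (adicCompletionPrime K v) hm
    rwa [Ne, IsLocalRing.residue_eq_zero_iff, IsLocalRing.mem_maximalIdeal, mem_nonunits_iff, not_not] at h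
  have hdu := unit_of_notMem hd
  have han : a * absIntegersToValuationSubring _ d = absIntegersToValuationSubring _ n := Subtype.ext hnd
  have h1 : IsUnit ((absClosureEmbedding K (v.adicCompletion K)).toRingHom.restrict
      (absIntegersValuationSubring (adicCompletionPrime K v)) (closureValuationSubring (v.adicCompletion K))
      (forall_absClosureEmbedding_mem_closureValuationSubring_adicCompletion K v)
      (absIntegersToValuationSubring (absIntegersValuationSubring (adicCompletionPrime K v)) n)) := by
    rw [← han, map_mul]
    exact ha.mul (hdu.map _)
  have hn𝔓 : n ∉ adicCompletionPrime K v := by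
    intro hmem
    rw [mem_adicCompletionPrime_iff_mem_nonunits K v] at hmem
    have hmem' := (ValuationSubring.coe_mem_nonunits_iff (a := (⟨_,
      absClosureEmbedding_coe_absIntegers_mem_closureValuationSubring_adicCompletion K v n⟩ :
        closureValuationSubring (v.adicCompletion K)))).mp hmem
    exact (IsLocalRing.mem_maximalIdeal _).mp hmem' h1
  have hnu := unit_of_notMem hn𝔓
  obtain ⟨u, hu⟩ := hdu
  have hau : a = absIntegersToValuationSubring _ n *
      ((u⁻¹ : (absIntegersValuationSubring (adicCompletionPrime K v))ˣ) :
        absIntegersValuationSubring (adicCompletionPrime K v)) := by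
    rw [← han, ← hu, mul_assoc, Units.mul_inv, mul_one]
  rw [hau]
  exact hnu.mul (Units.isUnit _)

omit [ValuativeRel (v.adicCompletion K)] [IsNonarchimedeanLocalField (v.adicCompletion K)] in
/-- `𝓞_{K,v} ⊆ ℤ̄_{𝔓₀}`: the `RingHom.restrict` hypothesis for the structure map `f′ : 𝓞_{K,v} → ℤ̄_{𝔓₀}`.
[cite: NeukirchANT1999, Ch. II §8] -/
theorem forall_algebraMap_mem_absIntegersValuationSubring_adicCompletionPrime :
    haveI := adicCompletionPrime_isMaximal K v
    ∀ a ∈ HeightOneSpectrum.valuationSubringAtPrime K v,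
      algebraMap K (AlgebraicClosure K) a ∈ absIntegersValuationSubring (adicCompletionPrime K v) :=
  haveI := adicCompletionPrime_isMaximal K v
  fun _ ha => algebraMap_mem_absIntegersValuationSubring (adicCompletionPrime K v)
    (adicCompletionPrime_mem_primesAbove K v) ha

end Completion




end Literature.NumberTheory.GaloisRepresentations

end
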